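import Summits.Ventures.PercRepro.S2ThirteenEight
import Summits.Ventures.PercRepro.S2FlatSharp
import Summits.Ventures.PercRepro.S2SpreadTail
import Summits.Ventures.PercRepro.S2CountsCell
import Summits.Ventures.PercRepro.S1SpreadCapsEight

/-!
# PercRepro — S2: THE SPREAD CASE OF THE COLOOP-FREE CELL `(13, 8)`, AND THE CELL MODULO `ν = 4` AND ITS SUB-CELLS (p7, gen 17)

On a coloop-free spread `e`-free core of rank `13` on `21` points (no set of nullity `4` on `≤ 9` points: the rank-`5` sets have `≤ 8`
points, the rank-`4` sets `≤ 7`), p1 g35's unconditional nullity-`8` spread caps `s₄ ≤ 64` (`S1.ncard_fourCircuits_le_sixty_four_spread_twenty_one`)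
and `s₅ ≤ 231` (`S1.ncard_fiveCircuits_le_two_thirty_one_thirteen_eight`) with `s₃ ≤ 13` feed the kit's spread levers uniformly:
the top count by `ThmN.topCount_le_flat_sharp` at `(f, f′) = (8, 7)` (`U ≤ 820498/15 < 54700`), the rank part of the tail by
`ncard_eRk_le_five_le_spread` (`392648/5`) and the spanning count by the kit (`Σ_{m ≤ 8} C(21, m) = 401930`): `m = 235`, the need
`(1024 − 235)·8·9480/1024 = 58435.3` — ratio `0.94` (the global caps `85 / 526` read `1.13`). **`c025_thirteen_eight_cf_spread`**; with
S2ThirteenEight: **`c025_core_five_thirteen_eight_of_nu_four_of_cells (hnu4) (hk1) (hk2) : RLS M 13 5`** — THE CELL `(13, 8)` MODULO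
ITS CASE `ν = 4` AND ITS TWO SUB-CELLS. Nothing about the cell is claimed. Axioms: standard.
-/

open scoped Matroid

namespace PercRepro

namespace ThmN

open Set

variable {α : Type}

/-- **The spread case of the coloop-free cell `(13, 8)`**, on p1's nullity-`8` spread caps. -/
theorem c025_thirteen_eight_cf_spread (M : Matroid α) [M.Finite]
    (hR : M.eRank = ((13 : ℕ) : ℕ∞)) (hn : M.E.ncard = 13 + 8)
    (hfree : ∀ e ∈ M.E, ∃ A ⊆ M.E \ {e}, e ∉ M.closure A ∧ e ∉ M.closure ((M.E \ {e}) \ A)) (hK : ∀ e, ¬ M.IsColoop e)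
    (h4 : ¬ ∃ W ⊆ M.E, W.ncard ≤ 9 ∧ W.encard = M.eRk W + 4) : RLS M 13 5 := by
  classical
  have hd : M.E.encard = M.eRank + ((8 : ℕ) : ℕ∞) := by
    rw [hR, ← M.ground_finite.cast_ncard_eq, hn]
    push_cast
    ring
  have hd' : M.E.encard = M.eRank + 8 := by rw [hd]; rfl
  obtain ⟨hs3, -, -⟩ := caps_thirteen_eight_cf M hd hn hfree hK
  have hs4c := S1.ncard_fourCircuits_le_sixty_four_spread_twenty_one M hfree h4 hd' hn hK
  have hs5c := S1.ncard_fiveCircuits_le_two_thirty_one_thirteen_eight M hfree h4 hd' hn hK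
  have hflat : ∀ X ⊆ M.E, M.eRk X ≤ 5 → X.ncard ≤ 8 := fun X hX hr => by
    have := S2.ncard_le_of_eRk_le_of_not_nullity M 4 9 (by norm_num) h4 hX (r := 5) (by norm_num) (by exact_mod_cast hr)
    omega
  have hflat' : ∀ X ⊆ M.E, M.eRk X ≤ 4 → X.ncard ≤ 7 := fun X hX hr => by
    have := S2.ncard_le_of_eRk_le_of_not_nullity M 4 9 (by norm_num) h4 hX (r := 4) (by norm_num) (by exact_mod_cast hr)
    omega
  have hEcard : M.ground_finite.toFinset.card = 13 + 8 := by
    rw [← Set.ncard_eq_toFinset_card _ M.ground_finite]; exact hn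
  -- the top count (the spread lever with the triangle term), the tail and the spanning count
  have hU := topCount_le_flat_sharp M 13 8 (by norm_num) (by norm_num) hR hn hfree 8 7 hflat hflat' (by norm_num) (by norm_num)
    13 64 231 hs3 hs4c hs5c
  have hU' : Matroid.topCount M 13 5 ≤ 54700 := by
    have h : (Matroid.topCount M 13 5 : ℚ) ≤ 54700 := by
      refine hU.trans ?_
      norm_num [Finset.sum_range_succ, Nat.choose]
    exact_mod_cast h
  have hA := ncard_eRk_le_five_le_spread M 13 8 (by norm_num) hR hn hfree hflat hflat' 13 64 231 hs3 hs4c hs5c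
  have hA' : ({X : Set α | X ⊆ M.E ∧ M.eRk X ≤ 5}.ncard : ℚ) ≤ 392648 / 5 := by
    refine hA.trans ?_
    norm_num [Nat.choose]
  have hS' : {X : Set α | X ⊆ M.E ∧ M.eRk X = M.eRank}.ncard ≤ 401930 := by
    have hS := Matroid.ncard_spanning_le (M := M) hd
    rw [hEcard] at hS
    exact hS.trans (by decide)
  rw [RLS_iff]
  exact c025_core_five_cell_of_counts_xqictq5g M 13 8 (by norm_num) hR hn 54700 hU' _ hA' 401930 hS'
    9480 (by norm_num) (phiK 13 5) (by rw [phiK_thirteen_five]; norm_num) ⟨235, by norm_num, by norm_num, by norm_num⟩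

/-- **The cell `(13, 8)` modulo its case `ν = 4` and its two sub-cells** (the spread case and the cases `ν = 7, 6, 5` are theorems). -/
theorem c025_core_five_thirteen_eight_of_nu_four_of_cells
    (hnu4 : ∀ (M : Matroid α) [M.Finite], M.eRank = ((13 : ℕ) : ℕ∞) → M.E.ncard = 13 + 8 →
      (∀ e ∈ M.E, ∃ A ⊆ M.E \ {e}, e ∉ M.closure A ∧ e ∉ M.closure ((M.E \ {e}) \ A)) → (∀ e, ¬ M.IsColoop e) →
      ¬ (∃ W ⊆ M.E, W.ncard ≤ 12 ∧ W.encard = M.eRk W + 7) → ¬ (∃ W ⊆ M.E, W.ncard ≤ 11 ∧ W.encard = M.eRk W + 6) →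
      ¬ (∃ W ⊆ M.E, W.ncard ≤ 10 ∧ W.encard = M.eRk W + 5) → (∃ W ⊆ M.E, W.ncard ≤ 9 ∧ W.encard = M.eRk W + 4) → RLS M 13 5)
    (hk1 : ∀ (M : Matroid α) [M.Finite], M.eRank = ((12 : ℕ) : ℕ∞) → M.E.ncard = 12 + 8 →
      (∀ e ∈ M.E, ∃ A ⊆ M.E \ {e}, e ∉ M.closure A ∧ e ∉ M.closure ((M.E \ {e}) \ A)) → (∀ e, ¬ M.IsColoop e) →
      ((phiK 13 5 - 2) / 2) * (Matroid.topCount M 12 5 : ℚ) ≤ (Matroid.midCount M 12 5 : ℚ))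
    (hk2 : ∀ (M : Matroid α) [M.Finite], M.eRank = ((11 : ℕ) : ℕ∞) → M.E.ncard = 11 + 8 →
      (∀ e ∈ M.E, ∃ A ⊆ M.E \ {e}, e ∉ M.closure A ∧ e ∉ M.closure ((M.E \ {e}) \ A)) →
      ((phiK 13 5 - 6) / 4) * (Matroid.topCount M 11 5 : ℚ) ≤ (Matroid.midCount M 11 5 : ℚ))
    (M : Matroid α) [M.Finite]
    (hR : M.eRank = ((13 : ℕ) : ℕ∞)) (hn : M.E.ncard = 13 + 8)
    (hfree : ∀ e ∈ M.E, ∃ A ⊆ M.E \ {e}, e ∉ M.closure A ∧ e ∉ M.closure ((M.E \ {e}) \ A)) : RLS M 13 5 :=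
  c025_core_five_thirteen_eight_of_open hnu4
    (fun M' _ hR' hn' hfree' hK' h4' => c025_thirteen_eight_cf_spread M' hR' hn' hfree' hK' h4') hk1 hk2 M hR hn hfree

end ThmN

end PercRepro
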